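import Mathlib
import HarnessLib
import Literature.MathematicalPhysics.QuantumLattice.LatticeScalarField

/-!
# Stub `stub_riemannSqrt` (crux `SelfNormalisedMomentBoundsR`, line `Sketch`)

Piece A4 of the discrete phase-cell assembly: half of the Schwartz decay of a unit-seminorm
test function pays a Riemann sum.  If `‖f‖_{0,0} ≤ 1` and `‖f‖_{16,0} ≤ 1` then pointwise
`(1 + ‖y‖)¹⁶ |f y| ≤ 2¹⁶`, hence `√|f y| ≤ 2⁸ (1 + ‖y‖)⁻⁸`; summing against `a⁴` over a finite
set of lattice points and using the Riemann bound `a⁴ Σ_{x ∈ Λ} (1 + ‖a x − c‖)⁻⁸ ≤ K` at `c = 0`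
gives `Σ_{x ∈ Λ} a⁴ √|f(a x)| ≤ 2⁸ K`.
-/

noncomputable section

open scoped SchwartzMap BigOperators
open Literature.Probability.LatticeModels Literature.MathematicalPhysics.QuantumLattice

namespace Summit.QuantumFields.YangMills.Theorems.ScalingWindowSplit.SelfNormalisedMomentBoundsR

/-- Pointwise decay from the two unit seminorms: `(1 + ‖y‖)¹⁶ |f y| ≤ 2¹⁶`. -/
private theorem riemannSqrt_weighted_le (f : 𝓢(EuclideanSpace ℝ (Fin 4), ℝ))
    (h0 : SchwartzMap.seminorm ℝ 0 0 f ≤ 1) (h16 : SchwartzMap.seminorm ℝ 16 0 f ≤ 1)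
    (y : EuclideanSpace ℝ (Fin 4)) :
    (1 + ‖y‖) ^ 16 * |f y| ≤ 2 ^ 16 := by
  have hf0 : |f y| ≤ 1 := by
    have := SchwartzMap.norm_le_seminorm ℝ f y
    rw [Real.norm_eq_abs] at this
    exact this.trans h0
  have hf16 : ‖y‖ ^ 16 * |f y| ≤ 1 := by
    have := SchwartzMap.norm_pow_mul_le_seminorm ℝ f 16 y
    rw [Real.norm_eq_abs] at this
    exact this.trans h16
  have habs : 0 ≤ |f y| := abs_nonneg _
  have hn : 0 ≤ ‖y‖ := norm_nonneg _
  rcases le_or_gt ‖y‖ 1 with h | h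
  · -- near the origin: `(1 + ‖y‖)¹⁶ ≤ 2¹⁶` and `|f y| ≤ 1`
    have h1 : (1 + ‖y‖) ^ 16 ≤ 2 ^ 16 := by
      apply pow_le_pow_left₀ (by positivity)
      linarith
    calc (1 + ‖y‖) ^ 16 * |f y| ≤ 2 ^ 16 * 1 :=
          mul_le_mul h1 hf0 habs (by positivity)
      _ = 2 ^ 16 := by ring
  · -- far from the origin: `(1 + ‖y‖)¹⁶ ≤ 2¹⁶ ‖y‖¹⁶` and `‖y‖¹⁶ |f y| ≤ 1`
    have h1 : (1 + ‖y‖) ^ 16 ≤ (2 * ‖y‖) ^ 16 := by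
      apply pow_le_pow_left₀ (by positivity)
      linarith
    calc (1 + ‖y‖) ^ 16 * |f y| ≤ (2 * ‖y‖) ^ 16 * |f y| :=
          mul_le_mul_of_nonneg_right h1 habs
      _ = 2 ^ 16 * (‖y‖ ^ 16 * |f y|) := by ring
      _ ≤ 2 ^ 16 * 1 := by gcongr
      _ = 2 ^ 16 := by ring

/-- Pointwise square-root decay: `√|f y| ≤ 2⁸ (1 + ‖y‖)⁻⁸`. -/
private theorem riemannSqrt_sqrt_le (f : 𝓢(EuclideanSpace ℝ (Fin 4), ℝ))
    (h0 : SchwartzMap.seminorm ℝ 0 0 f ≤ 1) (h16 : SchwartzMap.seminorm ℝ 16 0 f ≤ 1)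
    (y : EuclideanSpace ℝ (Fin 4)) :
    Real.sqrt |f y| ≤ 2 ^ 8 * ((1 + ‖y‖)⁻¹) ^ 8 := by
  have hpos : 0 < 1 + ‖y‖ := by positivity
  have hw := riemannSqrt_weighted_le f h0 h16 y
  have hw1 : (1 + ‖y‖)⁻¹ * (1 + ‖y‖) = 1 := inv_mul_cancel₀ hpos.ne'
  have hle : |f y| ≤ (2 ^ 8 * ((1 + ‖y‖)⁻¹) ^ 8) ^ 2 :=
    calc |f y| = ((1 + ‖y‖)⁻¹ * (1 + ‖y‖)) ^ 16 * |f y| := by rw [hw1, one_pow, one_mul]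
      _ = ((1 + ‖y‖)⁻¹) ^ 16 * ((1 + ‖y‖) ^ 16 * |f y|) := by ring
      _ ≤ ((1 + ‖y‖)⁻¹) ^ 16 * 2 ^ 16 := by gcongr
      _ = (2 ^ 8 * ((1 + ‖y‖)⁻¹) ^ 8) ^ 2 := by ring
  calc Real.sqrt |f y| ≤ Real.sqrt ((2 ^ 8 * ((1 + ‖y‖)⁻¹) ^ 8) ^ 2) := Real.sqrt_le_sqrt hle
    _ = 2 ^ 8 * ((1 + ‖y‖)⁻¹) ^ 8 := Real.sqrt_sq (by positivity)

/-- **Stub `stub_riemannSqrt` (line `Sketch`; piece A4 of the assembly).**  Half of the Schwartz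
decay pays the Riemann sum: if `‖f‖_{0,0}, ‖f‖_{16,0} ≤ 1` then `√|f(y)| ≤ 2⁸ (1 + ‖y‖)⁻⁸`, so the
Riemann bound for the weight `(1 + ‖·‖)⁻⁸` gives `Σ_{x ∈ Λ} a⁴ √|f(a x)| ≤ 2⁸ K`. -/
theorem stub_riemannSqrt :
    ∀ (K : ℝ), (∀ (a : ℝ), 0 < a → a ≤ 1 → ∀ (c : EuclideanSpace ℝ (Fin 4)) (Λ : Finset (Site 4)),
      a ^ 4 * ∑ x ∈ Λ, ((1 + ‖a • siteToE x - c‖)⁻¹) ^ 8 ≤ K) →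
    ∀ (a : ℝ), 0 < a → a ≤ 1 → ∀ (f : 𝓢(EuclideanSpace ℝ (Fin 4), ℝ)),
      SchwartzMap.seminorm ℝ 0 0 f ≤ 1 → SchwartzMap.seminorm ℝ 16 0 f ≤ 1 →
      ∀ Λ : Finset (Site 4), ∑ x ∈ Λ, a ^ 4 * Real.sqrt |f (a • siteToE x)| ≤ 2 ^ 8 * K := by
  intro K hK a ha ha1 f h0 h16 Λ
  -- the Riemann bound at centre `c = 0`
  have hKa : a ^ 4 * ∑ x ∈ Λ, ((1 + ‖a • siteToE x‖)⁻¹) ^ 8 ≤ K := by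
    simpa only [sub_zero] using hK a ha ha1 0 Λ
  calc ∑ x ∈ Λ, a ^ 4 * Real.sqrt |f (a • siteToE x)|
      ≤ ∑ x ∈ Λ, a ^ 4 * (2 ^ 8 * ((1 + ‖a • siteToE x‖)⁻¹) ^ 8) :=
        Finset.sum_le_sum fun x _ =>
          mul_le_mul_of_nonneg_left (riemannSqrt_sqrt_le f h0 h16 _) (pow_nonneg ha.le 4)
    _ = 2 ^ 8 * (a ^ 4 * ∑ x ∈ Λ, ((1 + ‖a • siteToE x‖)⁻¹) ^ 8) := by
        rw [Finset.mul_sum, Finset.mul_sum]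
        exact Finset.sum_congr rfl fun x _ => by ring
    _ ≤ 2 ^ 8 * K := by gcongr

end Summit.QuantumFields.YangMills.Theorems.ScalingWindowSplit.SelfNormalisedMomentBoundsR

end
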